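import Summits.QuantumFields.YangMills.Theorems.UnitScaleTiltFluctuationComparisonRegPrGlobalSlackKernelLegWeighted
import HarnessLib

/-!
# `UnitScaleTiltFluctuationComparisonRegPrGlobalSlackKernelLegAnalyticOwn` — LEG-WEIGHTED ANALYTICITY (R2′) IN EACH RUN'S OWN INDEXING
# (crux `FluctuationComparisonRegPrIntL`, stmt-QuantumFields-20520, skeleton v5kC, STUB 3⁗χ; width seat ym-ust-20520-w1 g0, count-neutral helper)

WHY.  In the display-level socket `K1aLegRowsOwnAChi` (p585428) the kernel row is lane A's `ChartAnalyticΦ D (rescaleΦw dist κ′ Φ) κ ρ C_A`, which — like every row of record — carries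
TWO clauses indexed by run `K`'s localisation domains (run `K`'s rescaled chart at `(b, Y)`, and run `K+1`'s at `(b+1, refineSet Y)` with run `K`'s tree length).  A per-run
record displays ONE clause in its own indexing.  This file gives the own-indexed form and the geometric transfer, as `…KernelLegRefOwn` / `…KernelLegPerRun` did for the other rows:

* §1 `chartAnalyticityAsCited_mono` (the binder is monotone in its bound), **`ChartAnalyticOwnΦ D Φ κ ρ C_A`** (one clause: for `Y ∈ Loc K k triv (1+b)`, `Φ K b Y` holomorphic on
  `ball 0 ρ`, `≤ C_A e^{−κ𝓛_K(1+b,Y)}` on the half-ball) and **`chartAnalyticΦ_of_own`** (`LocMatched ∧ TreeLenRefinedOn ∧ 0 ≤ κ ∧ 0 ≤ C_A ⟹` the two-clause row: run `K+1`'s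
  clause is its own clause at `(K+1, k+1, b+1, refineSet Y)`, with the larger tree length giving the smaller bound);
* §2 the χ-instance for the RESCALED canonical family: `chartAnalyticLegΦ_chi_of_own` — so (R2′) of `K1aLegRowsOwnAChi` is «`ChartAnalyticOwnΦ D (rescaleΦw (canonLegDist F) κ′ Φ) 𝔠.κ ρ C_A`»,
  a `∀ K`-statement about run `K`'s charts on run `K`'s own domains (the rescaling `D_w` is run-local: `legD (canonLegDist F) κ′ K b Y`).
HONEST FRAMING: bookkeeping + geometry over hypothesis schemas; nothing of [Balaban1985UV3]/[King1986] asserted; registry untouched; YM₃ on T³ is a rung, not the Clay problem.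

References: T. Bałaban, CMP 102 (1985) 255–275 [Balaban1985UV3] ((25) p.262, (29)–(30) p.263, (43) p.266, (45) p.267); CMP 109 (1987) 249–301 [Balaban1987RG1] ((0.1) p.251).
-/

set_option autoImplicit false

noncomputable section

open scoped BigOperators
open Finset Metric
open Literature.MathematicalPhysics.QuantumFieldTheory.Balaban1983to89
open Literature.MathematicalPhysics.QuantumFieldTheory.Balaban1983to89.T3ContinuumYM3Torus
open Literature.MathematicalPhysics.QuantumFieldTheory.Balaban1983to89.T3UnitScaleTilt
open Literature.MathematicalPhysics.QuantumFieldTheory.Balaban1983to89.T3LevelShift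
open Literature.MathematicalPhysics.QuantumFieldTheory.Balaban1983to89.T3AlphaInputsAC
open Literature.MathematicalPhysics.QuantumFieldTheory.Balaban1983to89.T3AlphaPolymerSocket
open Literature.MathematicalPhysics.QuantumFieldTheory.Balaban1983to89.T3AlphaInputsACTwoRun
open Literature.MathematicalPhysics.QuantumFieldTheory.Balaban1983to89.T3AlphaInputsACTwoRunLevel
open Literature.MathematicalPhysics.QuantumFieldTheory.Balaban1985CMP102
open Literature.MathematicalPhysics.QuantumFieldTheory.Balaban1985CMP102.Setting
open Literature.MathematicalPhysics.QuantumFieldTheory.Balaban1985CMP102.Binders (ChartAnalyticityAsCited)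
open Summit.QuantumFields.Balaban3D.Carriers
open Summit.QuantumFields.Balaban3D.Proofs.Primitives
open Summit.QuantumFields.Balaban3D.Proofs.GroupModelLieC (lieC)
open Summit.QuantumFields.YangMills.Theorems
open Summit.QuantumFields.YangMills.Theorems.GlobalSlackKernelMatching
open Summit.QuantumFields.YangMills.Theorems.GlobalSlackCanonicalPolymers

namespace Summit.QuantumFields.YangMills.Theorems.GlobalSlackKernelLeg

/-! ## §1 The own-indexed analyticity row and its transfer -/

section Own

variable {𝕍 : Type} [NormedAddCommGroup 𝕍] [NormedSpace ℂ 𝕍] {F : T3Family} {γ : ℝ}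

/-- The binder G3D-01 is monotone in its bound. [cite: Balaban1985UV3, (30) p.263] -/
theorem chartAnalyticityAsCited_mono {E : Type} [NormedAddCommGroup E] [NormedSpace ℂ E] {Ψ : E → ℂ} {ρ M M' : ℝ}
    (h : ChartAnalyticityAsCited Ψ ρ M) (hM : M ≤ M') : ChartAnalyticityAsCited Ψ ρ M' :=
  ⟨h.1, h.2.1, fun z hz => (h.2.2 z hz).trans hM⟩

/-- **THE OWN-INDEXED ANALYTICITY ROW** (hypothesis schema, never asserted; G3D-01 in chart-family currency, ONE run): for every listed domain `Y ∈ Loc K k triv (1+b)` of run `K`,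
the chart `Φ K b Y` is holomorphic on `ball 0 ρ` and bounded by `C_A·e^{−κ𝓛_K(1+b, Y)}` on `closedBall 0 (ρ/2)`.  Applied to a leg-rescaled family `rescaleΦw dist κ′ Φ` this is
LEG-WEIGHTED analyticity (print p.264: the propagator chains from each leg to the domain). [cite: Balaban1985UV3, (25) p.262, (29)-(30) p.263, (33)-(34) p.264] -/
def ChartAnalyticOwnΦ (D : AlphaDataT3 F γ) (Φ : ChartFam 𝕍 F) (κ ρ C_A : ℝ) : Prop :=
  ∀ (K k b : ℕ) (Y : Set (Site (F.P K) 0)), Y ∈ D.Loc K k (D.triv K k) (1 + b) →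
    ChartAnalyticityAsCited (Φ K b Y) ρ (C_A * Real.exp (-κ * D.treeLen K (1 + b) Y))

/-- **THE OWN-INDEXED ANALYTICITY ROW GIVES THE TWO-CLAUSE ROW OF RECORD**: `ChartAnalyticOwnΦ … C_A → ChartAnalyticΦ … C_A` (`LocMatched`: run `K`'s level-`(1+b)` domains at lattice
level `k ≤ K` refine to run `K+1`'s level-`(2+b)` domains; `TreeLenRefinedOn` + `0 ≤ κ`, `0 ≤ C_A`: the refined chart's own bound `C_A e^{−κ𝓛_{K+1}}` is below `C_A e^{−κ𝓛_K}`).  The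
dummy whole-torus domain above the top (`k > K`) is outside `LocMatched`'s range; there the row of record asks for the refined chart at `(b+1, univ)` too, which an own-indexed record
covers only if it lists that domain — so this transfer is stated for lattice levels `k ≤ K` via the hypothesis `hLoc` in `LocMatched`'s own range and the extra hypothesis `hTop`
for the levels above the top. [cite: Balaban1985UV3, (24)-(25) p.262; Balaban1987RG1, (0.1) p.251] -/
theorem chartAnalyticΦ_of_own {D : AlphaDataT3 F γ} {Φ : ChartFam 𝕍 F} {κ ρ C_A : ℝ}
    (hLoc : ∀ (K k b : ℕ) (Y : Set (Site (F.P K) 0)), Y ∈ D.Loc K k (D.triv K k) (1 + b) →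
      refineSet F K Y ∈ D.Loc (K + 1) (k + 1) (D.triv (K + 1) (k + 1)) (1 + (b + 1)) ∨
        ChartAnalyticityAsCited (Φ (K + 1) (b + 1) (refineSet F K Y)) ρ (C_A * Real.exp (-κ * D.treeLen K (1 + b) Y)))
    (hT : TreeLenRefinedOn D) (hκ : 0 ≤ κ) (hCA : 0 ≤ C_A)
    (h : ChartAnalyticOwnΦ D Φ κ ρ C_A) : ChartAnalyticΦ D Φ κ ρ C_A := by
  intro K k b Y hY
  refine ⟨h K k b Y hY, ?_⟩
  rcases hLoc K k b Y hY with hY' | hdirect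
  · have hown := h (K + 1) (k + 1) (b + 1) (refineSet F K Y) hY'
    refine chartAnalyticityAsCited_mono hown (mul_le_mul_of_nonneg_left ?_ hCA)
    exact Real.exp_le_exp.mpr (by nlinarith [hT K k b Y hY])
  · exact hdirect

end Own

/-! ## §2 At the χ-record's canonical polymerisation, below the top -/

section Chi

variable {F : T3Family} {𝔠 : AlphaConsts F.L (suGroupModel 2).N} {γ : ℝ} {hγ : 0 < γ} {hγ1 : γ ≤ (min 𝔠.gamma0 1) ^ 2}

/-- **AT LATTICE LEVELS BELOW THE TOP, RUN `K`'S LISTED DOMAINS REFINE TO RUN `K+1`'S** (the canonical polymerisation; `locMatched_canonCore` in `MapsTo` form): if `k ≤ K` and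
`Y ∈ canonLocCore q K k triv (1+b)` then `refineSet Y ∈ canonLocCore q (K+1) (k+1) triv (2+b)` (the listed term levels at lattice level `k` being `≤ k`). [cite: Balaban1987RG1, (0.1) p.251] -/
theorem refineSet_mem_canonLocCore (q : ∀ K, AlphaInputsT3AC.PkgCoreV3 F 𝔠 γ hγ hγ1 K) {K k b : ℕ} (hk : k ≤ K) {Y : Set (Site (F.P K) 0)}
    (hY : Y ∈ canonLocCore q K k (Hist.triv (F.P K) k) (1 + b)) :
    refineSet F K Y ∈ canonLocCore q (K + 1) (k + 1) (Hist.triv (F.P (K + 1)) (k + 1)) (1 + (b + 1)) := by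
  classical
  -- `1 + b ≤ k`: the listed term levels at lattice level `k ≤ K` are `≤ k`
  have hbk : 1 + b ≤ k := by
    cases k with
    | zero => simp [canonLocCore] at hY
    | succ j =>
      have hj : j + 1 ≤ K := hk
      by_cases hi : 1 + b = j + 1
      · omega
      · by_cases hi' : 1 + b ∈ Finset.Icc 1 j
        · have := (Finset.mem_Icc.mp hi').2; omega
        · simp only [canonLocCore, if_pos hj, if_neg hi, if_neg hi'] at hY
          simp at hY
  have hmaps := (locMatched_canonCore q K (K - k) (by omega) (1 + b) (by omega) (by omega)).mapsTo
  rw [show K - (K - k) = k by omega, show K + 1 - (K - k) = k + 1 by omega] at hmaps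
  have := hmaps (Finset.mem_coe.mpr hY)
  rw [show 1 + (b + 1) = 1 + b + 1 by ring]
  exact Finset.mem_coe.mp this

/-- **(R2′) OF `K1aLegRowsOwnAChi` FROM ITS OWN-INDEXED FORM, at the χ-datum**, given the own row for the RESCALED family at every lattice level and, above the top (`k > K`, the dummy
whole-torus domain only), the refined clause directly (`hTop`).  Decay `κ ≥ 0` (e.g. `𝔠.κ`), `C_A ≥ 0`. [cite: Balaban1985UV3, (25) p.262, (29)-(30) p.263; Balaban1987RG1, (0.1) p.251] -/
theorem chartAnalyticLegΦ_chi_of_own (p : ∀ K, AlphaInputsT3AC.PkgAtV3Chi F 𝔠 γ hγ hγ1 K) {Φ : ChartFam ↥(lieC (suGroupModel 2)) F} {κ' κ ρ C_A : ℝ}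
    (hκ : 0 ≤ κ) (hCA : 0 ≤ C_A)
    (hTop : ∀ (K k b : ℕ) (Y : Set (Site (F.P K) 0)), K < k →
      Y ∈ (AlphaInputsT3AC.dataOfV3chi p (canonPolymerCore fun K => (p K).toCore)).Loc K k
        ((AlphaInputsT3AC.dataOfV3chi p (canonPolymerCore fun K => (p K).toCore)).triv K k) (1 + b) →
      ChartAnalyticityAsCited (rescaleΦw (canonLegDist F) κ' Φ (K + 1) (b + 1) (refineSet F K Y)) ρ
        (C_A * Real.exp (-κ * (AlphaInputsT3AC.dataOfV3chi p (canonPolymerCore fun K => (p K).toCore)).treeLen K (1 + b) Y)))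
    (h : ChartAnalyticOwnΦ (AlphaInputsT3AC.dataOfV3chi p (canonPolymerCore fun K => (p K).toCore)) (rescaleΦw (canonLegDist F) κ' Φ) κ ρ C_A) :
    ChartAnalyticΦ (AlphaInputsT3AC.dataOfV3chi p (canonPolymerCore fun K => (p K).toCore)) (rescaleΦw (canonLegDist F) κ' Φ) κ ρ C_A := by
  refine chartAnalyticΦ_of_own (fun K k b Y hY => ?_) (treeLenRefinedOn_canonCore fun K => (p K).toCore) hκ hCA h
  by_cases hk : k ≤ K
  · exact Or.inl (refineSet_mem_canonLocCore (fun K => (p K).toCore) hk hY)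
  · exact Or.inr (hTop K k b Y (by omega) hY)

end Chi

end Summit.QuantumFields.YangMills.Theorems.GlobalSlackKernelLeg

end
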